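import Mathlib
import Summits.Ventures.PercRepro2.SwOutAll
import Summits.Ventures.PercRepro2.SwOutSeriesDefs
import Summits.Ventures.PercRepro2.SwOutSeriesContract
import Summits.Ventures.PercRepro2.SwOutSeriesContractCount
import Summits.Ventures.PercRepro2.SwOutSeriesDelete
import Summits.Ventures.PercRepro2.SwOutSeriesDeleteCount
import Summits.Ventures.PercRepro2.SwOutSeriesThm
import Summits.Ventures.PercRepro2.SwOutLeaf
import Summits.Ventures.PercRepro2.SwOutLeafThm
import Summits.Ventures.PercRepro2.SwOutLoop
import Summits.Ventures.PercRepro2.SwOutLoopThm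
import Summits.Ventures.PercRepro2.SwOutReducible
import Summits.Ventures.PercRepro2.SwOutArmFlip
import Summits.Ventures.PercRepro2.SwOutArms
import Summits.Ventures.PercRepro2.SwOutArmOrbit
import Summits.Ventures.PercRepro2.SwOutArmCube
import Summits.Ventures.PercRepro2.SwOutArmThm

import Summits.Ventures.PercRepro2.SwOutCyclicDefs

/-!
# THEOREM C in the kernel: cyclic regions are reducible, (SW) on every cycle + apex graph (blind
cell PercRepro2, night-4 g10, 2026-08-25; proofs/NIGHT4-G10.md §4, §7)

**`reducible_of_cyclicRegion`**: every cyclic region is series-reducible (strong induction on the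
number of bad edges: a loop at `h` or at a path vertex is parked, a path vertex with one edge is
peeled, with two edges contracted / deleted; when no bad edge is left the arm principle is the
base).  **`sw_of_cyclic`**: row (SW) on every graph whose region `V ∖ {l}` is cyclic — every vertex
other than `l, h, o` is joined to `l` or has at most two edges among the vertices other than `l`;
`G − l` a cycle through `h` (wheels, fans, cycle + apex) and the complete graphs are instances.
-/

namespace Summit.Ventures.PercRepro2

namespace LocRows

open Hull

variable {V : Type*} {E : Type*} [Fintype E] [DecidableEq E]

open scoped Classical

variable {ends : E → Sym2 V} {l h o : V}

section Main

variable (hlh : l ≠ h)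
include hlh

/-- **Cyclic regions are series-reducible** (induction on the bad edges). -/
theorem reducible_of_cyclicRegion (n : ℕ) :
    ∀ (ends : E → Sym2 V) (U : Set V), (badEdges ends h o U).card = n → l ∉ U → h ∈ U →
      CyclicRegion ends h o U → Reducible l h o ends U := by
  induction n using Nat.strong_induction_on with
  | _ n ih =>
  intro ends U hn hl hU hcyc
  by_cases hbad : badEdges ends h o U = ∅
  · -- BASE: no bad edge — the arm principle
    refine Reducible.base ends U fun ξ 𝓔 h𝓔 => rigidOK_of_outEdges' (ξ := ξ) hl ?_ ?_ h𝓔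
    · intro e he
      have : e ∈ badEdges ends h o U := mem_badEdges.2 (Or.inr he)
      exact absurd this (by rw [hbad]; exact Finset.notMem_empty e)
    · intro x hxU hxh hxo
      by_cases hx : HasOut ends U x
      · exact Or.inl hx
      · right
        intro e hxe
        have : e ∈ badEdges ends h o U := mem_badEdges.2 (Or.inl ⟨x, hxe, hxU, hxh, hxo, hx⟩)
        exact absurd this (by rw [hbad]; exact Finset.notMem_empty e)
  obtain ⟨e₀, he₀⟩ := Finset.nonempty_iff_ne_empty.2 hbad
  rcases mem_badEdges.1 he₀ with ⟨x, hxe₀, hxU, hxh, hxo, hxout⟩ | hloop₀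
  · -- a bad vertex `x` with the edge `e₀`: a path vertex
    have hxl : x ≠ l := by rintro rfl; exact hl hxU
    rcases hcyc x hxU hxh hxo with hout | ⟨hin, hcard⟩
    · exact absurd hout hxout
    by_cases hloopx : ∃ e, ends e = s(x, x)
    · -- (B1) a loop at `x`: park it
      obtain ⟨e₁, he₁⟩ := hloopx
      have he₁bad : e₁ ∈ badEdges ends h o U :=
        mem_badEdges.2 (Or.inl ⟨x, by rw [he₁]; exact Sym2.mem_mk_left x x, hxU, hxh, hxo, hxout⟩)
      refine Reducible.loop ends U x e₁ he₁ hxU hl (ih _ ?_ _ _ rfl hl hU ?_)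
      · rw [← hn]
        refine card_badEdges_lt he₁bad ?_
        intro e he
        rw [Finset.mem_erase]
        have hne : e ≠ e₁ := by
          rintro rfl
          rw [mem_badEdges, parkLoop_apply_e₁] at he
          rcases he with ⟨y, hy, hyU, _⟩ | hll
          · rw [Sym2.mem_iff] at hy
            rcases hy with rfl | rfl <;> exact hl hyU
          · rw [Sym2.eq_iff] at hll
            rcases hll with ⟨h', _⟩ | ⟨h', _⟩ <;> exact hlh h'
        refine ⟨hne, mem_badEdges_of_agree (subset_refl U) ?_ (parkLoop_apply_of_ne hne) he⟩
        intro y hyU hy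
        refine hasOut_transfer (subset_refl U) ?_ hy
        intro e' ⟨z, hz, hzU⟩
        have : e' ≠ e₁ := by
          rintro rfl
          rw [he₁, Sym2.mem_iff] at hz
          rcases hz with rfl | rfl <;> exact hzU hxU
        exact parkLoop_apply_of_ne this
      · -- the parked graph is cyclic
        intro y hyU hyh hyo
        rcases hcyc y hyU hyh hyo with hout | ⟨hin', hcard'⟩
        · left
          refine hasOut_transfer (subset_refl U) ?_ hout
          intro e' ⟨z, hz, hzU⟩
          have : e' ≠ e₁ := by
            rintro rfl
            rw [he₁, Sym2.mem_iff] at hz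
            rcases hz with rfl | rfl <;> exact hzU hxU
          exact parkLoop_apply_of_ne this
        · right
          have hsub : edgesAt (parkLoop ends l e₁) y ⊆ edgesAt ends y := by
            refine edgesAt_subset_of fun e' hy' => ?_
            by_cases h' : e' = e₁
            · subst h'
              rw [parkLoop_apply_e₁, Sym2.mem_iff] at hy'
              rcases hy' with rfl | rfl <;> exact absurd hyU hl
            · rw [parkLoop_apply_of_ne h'] at hy'; exact hy'
          refine ⟨fun e' hy' z hz => ?_, (Finset.card_le_card hsub).trans hcard'⟩
          have h' : e' ≠ e₁ := by
            rintro rfl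
            rw [parkLoop_apply_e₁, Sym2.mem_iff] at hy'
            rcases hy' with rfl | rfl <;> exact absurd hyU hl
          rw [parkLoop_apply_of_ne h'] at hy' hz
          exact hin' e' hy' z hz
    · -- no loop at `x`: one or two edges
      have hloopx' : ∀ e, ends e ≠ s(x, x) := fun e he => hloopx ⟨e, he⟩
      obtain ⟨p, hp⟩ := Sym2.mem_iff_exists.1 hxe₀
      have hpx : p ≠ x := fun h' => hloopx' e₀ (by rw [hp, h'])
      have hpU : p ∈ U := hin e₀ hxe₀ p (by rw [hp]; exact Sym2.mem_mk_right x p)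
      have he₀at : e₀ ∈ edgesAt ends x := mem_edgesAt.2 hxe₀
      -- the edges at `x` are exactly `e₀` or exactly `{e₀, e₁}`
      rcases Nat.lt_or_ge (edgesAt ends x).card 2 with hlt | hge
      · -- (B2) one edge: a leaf
        have hone : edgesAt ends x = {e₀} := by
          have hpos : 0 < (edgesAt ends x).card := Finset.card_pos.2 ⟨e₀, he₀at⟩
          have : (edgesAt ends x).card = 1 := by omega
          obtain ⟨a, ha⟩ := Finset.card_eq_one.1 this
          rw [ha] at he₀at ⊢
          rw [Finset.mem_singleton] at he₀at
          rw [he₀at]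
        have hs : IsLeafAt ends x p e₀ := ⟨hp, hpx.symm, fun e he => by
          have : e ∈ edgesAt ends x := mem_edgesAt.2 he
          rw [hone, Finset.mem_singleton] at this; exact this⟩
        have hUx : U \ {x} ⊆ U := Set.sdiff_subset
        have hlx : l ∉ U \ {x} := fun h' => hl h'.1
        have hUx' : h ∈ U \ {x} := ⟨hU, fun h' => hxh (Set.mem_singleton_iff.1 h').symm⟩
        -- outside edges transfer (the leaf edge has both ends in `U`)
        have hout : ∀ y ∈ U \ {x}, HasOut ends U y → HasOut (deleteLeaf ends x e₀) (U \ {x}) y := by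
          intro y _ hy
          refine hasOut_transfer hUx ?_ hy
          intro e' ⟨z, hz, hzU⟩
          have : e' ≠ e₀ := by
            rintro rfl
            rw [hp, Sym2.mem_iff] at hz
            rcases hz with rfl | rfl
            · exact hzU hxU
            · exact hzU hpU
          exact deleteLeaf_apply_of_ne this
        refine Reducible.leaf ends U x p e₀ hs hxU hxh hxl hxo (ih _ ?_ _ _ rfl hlx hUx' ?_)
        · rw [← hn]
          refine card_badEdges_lt he₀ ?_
          intro e he
          rw [Finset.mem_erase]
          have hne : e ≠ e₀ := by
            rintro rfl
            rw [mem_badEdges, deleteLeaf_apply_e₁] at he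
            rcases he with ⟨y, hy, hyU, _⟩ | hll
            · rw [Sym2.mem_iff] at hy
              rcases hy with rfl | rfl <;> exact hyU.2 rfl
            · rw [Sym2.eq_iff] at hll
              rcases hll with ⟨h', _⟩ | ⟨h', _⟩ <;> exact hxh h'
          exact ⟨hne, mem_badEdges_of_agree hUx hout (deleteLeaf_apply_of_ne hne) he⟩
        · intro y hyU hyh hyo
          rcases hcyc y hyU.1 hyh hyo with hout' | ⟨hin', hcard'⟩
          · exact Or.inl (hout y hyU hout')
          · right
            have hye : ∀ e', y ∈ deleteLeaf ends x e₀ e' → e' ≠ e₀ ∧ y ∈ ends e' := by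
              intro e' hy'
              by_cases h' : e' = e₀
              · subst h'
                rw [deleteLeaf_apply_e₁, Sym2.mem_iff] at hy'
                rcases hy' with rfl | rfl <;> exact absurd rfl hyU.2
              · rw [deleteLeaf_apply_of_ne h'] at hy'; exact ⟨h', hy'⟩
            refine ⟨fun e' hy' z hz => ?_, (Finset.card_le_card
              (edgesAt_subset_of fun e' hy' => (hye e' hy').2)).trans hcard'⟩
            obtain ⟨h', hy''⟩ := hye e' hy'
            rw [deleteLeaf_apply_of_ne h'] at hz
            refine ⟨hin' e' hy'' z hz, ?_⟩
            rintro rfl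
            exact h' (hs.only e' hz)
      · -- (B3) two edges: a series vertex
        have htwo : (edgesAt ends x).card = 2 := le_antisymm hcard hge
        obtain ⟨a, b, hab, hS⟩ := Finset.card_eq_two.1 htwo
        -- the other edge `e₁`
        obtain ⟨e₁, hne, hS'⟩ : ∃ e₁, e₀ ≠ e₁ ∧ edgesAt ends x = {e₀, e₁} := by
          rw [hS] at he₀at
          rw [Finset.mem_insert, Finset.mem_singleton] at he₀at
          rcases he₀at with rfl | rfl
          · exact ⟨b, hab, hS⟩
          · exact ⟨a, hab.symm, by rw [hS, Finset.pair_comm]⟩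
        have hxe₁ : x ∈ ends e₁ := mem_edgesAt.1 (by rw [hS']; exact Finset.mem_insert_of_mem (Finset.mem_singleton_self e₁))
        obtain ⟨q, hq⟩ := Sym2.mem_iff_exists.1 hxe₁
        have hqx : q ≠ x := fun h' => hloopx' e₁ (by rw [hq, h'])
        have hqU : q ∈ U := hin e₁ hxe₁ q (by rw [hq]; exact Sym2.mem_mk_right x q)
        have honly : ∀ e, x ∈ ends e → e = e₀ ∨ e = e₁ := by
          intro e he
          have : e ∈ edgesAt ends x := mem_edgesAt.2 he
          rw [hS', Finset.mem_insert, Finset.mem_singleton] at this; exact this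
        have hs : IsSeriesAt ends x p q e₀ e₁ := ⟨hp, hq, hne, hpx.symm, hqx.symm, honly⟩
        have hUx : U \ {x} ⊆ U := Set.sdiff_subset
        have hlx : l ∉ U \ {x} := fun h' => hl h'.1
        have hUx' : h ∈ U \ {x} := ⟨hU, fun h' => hxh (Set.mem_singleton_iff.1 h').symm⟩
        -- an edge with an end outside `U` is neither `e₀` nor `e₁`
        have hnot : ∀ e', (∃ z ∈ ends e', z ∉ U) → e' ≠ e₀ ∧ e' ≠ e₁ := by
          rintro e' ⟨z, hz, hzU⟩
          constructor
          · rintro rfl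
            rw [hp, Sym2.mem_iff] at hz
            rcases hz with rfl | rfl
            · exact hzU hxU
            · exact hzU hpU
          · rintro rfl
            rw [hq, Sym2.mem_iff] at hz
            rcases hz with rfl | rfl
            · exact hzU hxU
            · exact hzU hqU
        have he₁bad : e₁ ∈ badEdges ends h o U := mem_badEdges.2 (Or.inl ⟨x, hxe₁, hxU, hxh, hxo, hxout⟩)
        -- CONTRACTION
        have houtC : ∀ y ∈ U \ {x}, HasOut ends U y →
            HasOut (contractSeries ends x p q e₀ e₁) (U \ {x}) y := by
          intro y _ hy
          refine hasOut_transfer hUx ?_ hy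
          intro e' hz
          exact contractSeries_apply_of_ne (hnot e' hz).1 (hnot e' hz).2
        have hcardC : (badEdges (contractSeries ends x p q e₀ e₁) h o (U \ {x})).card < n := by
          rw [← hn]
          refine card_badEdges_lt he₀ ?_
          intro e he
          rw [Finset.mem_erase]
          have hne₀ : e ≠ e₀ := by
            rintro rfl
            rw [mem_badEdges, contractSeries_apply_e₁] at he
            rcases he with ⟨y, hy, hyU, _⟩ | hll
            · rw [Sym2.mem_iff] at hy
              rcases hy with rfl | rfl <;> exact hyU.2 rfl
            · rw [Sym2.eq_iff] at hll
              rcases hll with ⟨h', _⟩ | ⟨h', _⟩ <;> exact hxh h'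
          refine ⟨hne₀, ?_⟩
          by_cases hne₁ : e = e₁
          · subst hne₁; exact he₁bad
          · exact mem_badEdges_of_agree hUx houtC (contractSeries_apply_of_ne hne₀ hne₁) he
        have hcycC := cyclicRegion_contract hcyc hne hp hq hpx hqx hpU hqU hin honly houtC
        -- DELETION
        have houtD : ∀ y ∈ U \ {x}, HasOut ends U y →
            HasOut (deleteSeries ends x e₀ e₁) (U \ {x}) y := by
          intro y _ hy
          refine hasOut_transfer hUx ?_ hy
          intro e' hz
          exact deleteSeries_apply_of_ne (hnot e' hz).1 (hnot e' hz).2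
        have hcardD : (badEdges (deleteSeries ends x e₀ e₁) h o (U \ {x})).card < n := by
          rw [← hn]
          refine card_badEdges_lt he₀ ?_
          intro e he
          rw [Finset.mem_erase]
          have hloopat : ∀ e', deleteSeries ends x e₀ e₁ e' = s(x, x) → e ≠ e' →
              e ∈ badEdges (deleteSeries ends x e₀ e₁) h o (U \ {x}) → True := fun _ _ _ _ => trivial
          have hnotbad : ∀ e', deleteSeries ends x e₀ e₁ e' = s(x, x) →
              e' ∉ badEdges (deleteSeries ends x e₀ e₁) h o (U \ {x}) := by
            intro e' he' hb
            rw [mem_badEdges, he'] at hb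
            rcases hb with ⟨y, hy, hyU, _⟩ | hll
            · rw [Sym2.mem_iff] at hy
              rcases hy with rfl | rfl <;> exact hyU.2 rfl
            · rw [Sym2.eq_iff] at hll
              rcases hll with ⟨h', _⟩ | ⟨h', _⟩ <;> exact hxh h'
          have hne₀ : e ≠ e₀ := by rintro rfl; exact hnotbad _ deleteSeries_apply_e₁ he
          have hne₁ : e ≠ e₁ := by rintro rfl; exact hnotbad _ (deleteSeries_apply_e₂ hne) he
          exact ⟨hne₀, mem_badEdges_of_agree hUx houtD (deleteSeries_apply_of_ne hne₀ hne₁) he⟩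
        have hcycD := cyclicRegion_delete hcyc hne hin honly houtD
        exact Reducible.series ends U x p q e₀ e₁ hs hxU hpU hxh hxl hxo
          (ih _ hcardC _ _ rfl hlx hUx' hcycC) (ih _ hcardD _ _ rfl hlx hUx' hcycD)
  · -- a loop at `h`: park it
    have hout : ∀ y ∈ U, HasOut ends U y → HasOut (parkLoop ends l e₀) U y := by
      intro y _ hy
      refine hasOut_transfer (subset_refl U) ?_ hy
      intro e' ⟨z, hz, hzU⟩
      have : e' ≠ e₀ := by
        rintro rfl
        rw [hloop₀, Sym2.mem_iff] at hz
        rcases hz with rfl | rfl <;> exact hzU hU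
      exact parkLoop_apply_of_ne this
    refine Reducible.loop ends U h e₀ hloop₀ hU hl (ih _ ?_ _ _ rfl hl hU ?_)
    · rw [← hn]
      refine card_badEdges_lt he₀ ?_
      intro e he
      rw [Finset.mem_erase]
      have hne : e ≠ e₀ := by
        rintro rfl
        rw [mem_badEdges, parkLoop_apply_e₁] at he
        rcases he with ⟨y, hy, hyU, _⟩ | hll
        · rw [Sym2.mem_iff] at hy
          rcases hy with rfl | rfl <;> exact hl hyU
        · rw [Sym2.eq_iff] at hll
          rcases hll with ⟨h', _⟩ | ⟨h', _⟩ <;> exact hlh h'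
      exact ⟨hne, mem_badEdges_of_agree (subset_refl U) hout (parkLoop_apply_of_ne hne) he⟩
    · intro y hyU hyh hyo
      rcases hcyc y hyU hyh hyo with hout' | ⟨hin', hcard'⟩
      · exact Or.inl (hout y hyU hout')
      · right
        have hye : ∀ e', y ∈ parkLoop ends l e₀ e' → e' ≠ e₀ ∧ y ∈ ends e' := by
          intro e' hy'
          by_cases h' : e' = e₀
          · subst h'
            rw [parkLoop_apply_e₁, Sym2.mem_iff] at hy'
            rcases hy' with rfl | rfl <;> exact absurd hyU hl
          · rw [parkLoop_apply_of_ne h'] at hy'; exact ⟨h', hy'⟩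
        refine ⟨fun e' hy' z hz => ?_, (Finset.card_le_card
          (edgesAt_subset_of fun e' hy' => (hye e' hy').2)).trans hcard'⟩
        obtain ⟨h', hy''⟩ := hye e' hy'
        rw [parkLoop_apply_of_ne h'] at hz
        exact hin' e' hy'' z hz

/-- **THEOREM C in the kernel — row (SW) on every graph whose region `V ∖ {l}` is cyclic**: every
vertex other than `l, h, o` is joined to `l` or has at most two edges, all among the vertices other
than `l` (in particular `G − l` a cycle through `h`: wheels, fans, cycle + apex). -/
theorem sw_of_cyclic (ends : E → Sym2 V) (hcyc : CyclicRegion ends h o ({l}ᶜ)) :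
    Sw ends l h o :=
  sw_of_reducible l h o hlh
    (reducible_of_cyclicRegion hlh _ ends ({l}ᶜ) rfl (by simp) (by simpa using hlh.symm) hcyc)

end Main

end LocRows

end Summit.Ventures.PercRepro2
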